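import Literature.IUT.HodgeArakelov.ThetaMonoidsMultiradialFunctor

/-!
# [IUTchII] §3, Prop 3.4 (i): the functoriality input REDUCED to an action of `Aut(Π^tp_{X̲̲_k})` on the reference
# theta-environment data (junction J10 of plan/L6/SUBDAG-IUTchII-Prop-31-33-34, genuine shape)

S. Mochizuki, *Inter-universal Teichmüller theory II*, §3, Prop 3.4 (i) p. 91 ("the left-hand square in each
diagram arises from the functoriality of the algorithms involved, relative to isomorphisms of projective systems of
mono-theta environments") and §1, Prop 1.2 (i) p. 25 ("a functorial group-theoretic algorithm `Π ↦ M^Θ_*(Π)`"),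
Example 1.9 (i)/(ii) p. 42 (functorial group-theoretic algorithms on the isomorphs of `Π^tp_{X̲̲_k}`)
[cite: Mochizuki2012, Prop 3.4 (i) p.91].  Claim key DISPUTED (D-0012); nothing here takes a side on [IUTchIII]
Cor 3.12.  abc-iut cell, layer L6, seat abc-iut-w5-d169 (W6-S6 holder lineage); companion of
`ThetaMonoidsMultiradialFunctor.lean` (J12).

The transport input `ThetaEnvTransport S` of J12 asks for theta-environment data on EVERY isomorph `Π` of
`Π^tp_{X̲̲_k}`, functorially in isomorphisms of topological groups.  A group-theoretic algorithm is given at ONE group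
and transported along isomorphisms; it is FUNCTORIAL on the groupoid of isomorphs exactly when its output at the
reference group `Π^tp_{X̲̲_k}` is acted on — compatibly — by the topological automorphisms of `Π^tp_{X̲̲_k}`.  This
file makes that reduction precise and kernel-checked:

* `ThetaEnvData.comapAlong E₀ φ` — transport of structure of theta-environment data along a group isomorphism
  `φ : Π ⥲ Π₀` (same ambient module, units, constants, theta sets; conjugation precomposed with `φ`), with the
  tautological isomorphism `comapIso : comapAlong E₀ φ ⥲ E₀` along `φ`;
* `ThetaEnvData.AutIsoAction E₀` — the GENUINE shape of J10: every topological automorphism `α` of the reference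
  group induces an isomorphism of the reference data `E₀ ⥲ E₀` ALONG `α`, functorially (identity ↦ identity,
  composite ↦ composite, on the module and index components) — for the genuine `θ_env` data this is the assembly of
  [EtTh] Cor 2.18 (i) (characteristic subgroups, FACT by name), abc-iut-L6-t1's `CohomologyAutFunctoriality`
  (transport on `lim_J H¹`), the orbit definition of `θ_env` (Cor 2.19: the classes form an `l·ℤ × μ₂`-ORBIT, hence a
  stable SET) and the group-theoreticity of `Ψ_cns` ([AbsTopIII] §3) — owners named, NOT built here; a degenerate
  inhabitant `AutIsoAction.trivial` certifies consistency;
* `ThetaEnvTransport.ofAutAction E₀ A` — THE reduction: from an `Aut`-action on the reference data, theta-environment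
  data on every isomorph (transport along a CHOSEN isomorphism `Π ⥲ Π^tp_{X̲̲_k}`, `Classical.choice` of the
  inhabited `IsoClass.iso`) and the induced isomorphisms along every `Π ⥲ Π*` (the action of the automorphism
  `Π^tp ⥲ Π ⥲ Π* ⥲ Π^tp`), with the functor laws PROVED; each `E(Π)` is `E₀` up to the isomorphism `baseIso`;
* `prop34i_multiradiallyDefined_ofAutAction` — J12 at this transport (instance of the J12 theorem).
-/

namespace Literature.IUT.HodgeArakelov

namespace TemperedThetaMonoids

open CategoryTheory

universe u

namespace ThetaEnvData

variable {P : Type u} [Group P] {P₀ : Type u} [Group P₀]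

/-! ### 1. Transport of structure along a group isomorphism -/

/-- **Transport of structure** of theta-environment data along a group isomorphism `φ : Π ⥲ Π₀`: the same ambient
module, unit group, constants, inversion indices and theta sets, with the conjugation action of `Π` obtained by
precomposing that of `Π₀` with `φ` ("the functoriality of the algorithms involved", p. 91).
[cite: Mochizuki2012, Prop 3.4 (i) p.91] -/
def comapAlong (E₀ : ThetaEnvData.{u, u} P₀) (φ : P ≃* P₀) : ThetaEnvData.{u, u} P where
  H := E₀.H
  conj := E₀.conj.comp φ.toMonoidHom
  Iota := E₀.Iota
  units := E₀.units
  constants := E₀.constants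
  units_eq := E₀.units_eq
  thetaEnv := E₀.thetaEnv
  inftyThetaEnv := E₀.inftyThetaEnv
  theta_subset := E₀.theta_subset

/-- The conjugation action of the transported data is `g ↦ conj (φ g)` (bookkeeping). [cite: Mochizuki2012, Prop 3.4 (i) p.91] -/
@[simp] theorem comapAlong_conj (E₀ : ThetaEnvData.{u, u} P₀) (φ : P ≃* P₀) (g : P) :
    (E₀.comapAlong φ).conj g = E₀.conj (φ g) := rfl

/-- The tautological isomorphism `comapAlong E₀ φ ⥲ E₀` ALONG `φ` (identity on the module and the indices).
[cite: Mochizuki2012, Prop 3.4 (i) p.91] -/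
def comapIso (E₀ : ThetaEnvData.{u, u} P₀) (φ : P ≃* P₀) : Iso (E₀.comapAlong φ) E₀ where
  phi := φ
  e := MulEquiv.refl _
  iota := Equiv.refl _
  map_conj _ _ := rfl
  map_units := by
    change E₀.units.map (MonoidHom.id _) = E₀.units
    exact Subgroup.map_id _
  map_constants := SetLike.coe_injective (by
    change ⇑(MulEquiv.refl _) '' (E₀.constants : Set E₀.H) = E₀.constants
    simp)
  image_thetaEnv ι := by
    change ⇑(MulEquiv.refl _) '' E₀.thetaEnv ι = E₀.thetaEnv ι
    simp
  image_inftyThetaEnv ι := by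
    change ⇑(MulEquiv.refl _) '' E₀.inftyThetaEnv ι = E₀.inftyThetaEnv ι
    simp

/-! ### 2. The genuine shape of the functoriality input: an `Aut(Π₀)`-action on the reference data by isomorphisms -/

variable [TopologicalSpace P₀] [IsTopologicalGroup P₀]

/-- **`Aut`-action on reference theta-environment data** (the genuine shape of junction J10): every topological
automorphism `α` of the reference group `Π₀ = Π^tp_{X̲̲_k}` induces an isomorphism of the data `E₀ ⥲ E₀` ALONG `α`
("Each isomorphism of projective systems of mono-theta environments `M^Θ_*(Π_v) ⥲ M^Θ_*(†F_v)` induces compatible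
collections of isomorphisms", p. 91, at `Π_v = †Π_v = Π^tp`; Prop 1.2 (i): automorphisms of `Π` act on `M^Θ_*(Π)`),
the identity inducing the identity and composites inducing composites on the module and index components.  DATA
(a hypothesis/data package, not a `Prop` fact).  [cite: Mochizuki2012, Prop 3.4 (i) p.91] -/
structure AutIsoAction (E₀ : ThetaEnvData.{u, u} P₀) : Type u where
  /-- the isomorphism of data induced by a topological automorphism of `Π₀` -/
  iso : (P₀ ≃ₜ* P₀) → Iso E₀ E₀
  /-- … lying over the automorphism -/
  iso_phi : ∀ (α : P₀ ≃ₜ* P₀) (g : P₀), (iso α).phi g = α g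
  /-- the identity induces the identity on the module … -/
  iso_refl_e : ∀ x : E₀.H, (iso (ContinuousMulEquiv.refl P₀)).e x = x
  /-- … and on the indices -/
  iso_refl_iota : ∀ ι : E₀.Iota, (iso (ContinuousMulEquiv.refl P₀)).iota ι = ι
  /-- composites induce composites on the module … -/
  iso_trans_e : ∀ (α β : P₀ ≃ₜ* P₀) (x : E₀.H), (iso (α.trans β)).e x = (iso β).e ((iso α).e x)
  /-- … and on the indices -/
  iso_trans_iota : ∀ (α β : P₀ ≃ₜ* P₀) (ι : E₀.Iota), (iso (α.trans β)).iota ι = (iso β).iota ((iso α).iota ι)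

/-- A DEGENERATE inhabitant: on the degenerate datum every automorphism acts by the identity on the (trivial)
module (interface consistency only). [folklore] -/
def AutIsoAction.trivial (P₀ : Type u) [Group P₀] [TopologicalSpace P₀] [IsTopologicalGroup P₀] :
    AutIsoAction (ThetaEnvTransport.trivialData P₀) where
  iso α := ThetaEnvTransport.trivialIso α.toMulEquiv
  iso_phi _ _ := rfl
  iso_refl_e _ := rfl
  iso_refl_iota _ := rfl
  iso_trans_e _ _ _ := rfl
  iso_trans_iota _ _ _ := rfl

end ThetaEnvData

/-! ### 3. From an `Aut(Π^tp_{X̲̲_k})`-action to theta-environment data on every isomorph, functorially -/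

namespace ThetaEnvTransport

variable {S : ThetaSetting.{u}}

/-- A CHOSEN isomorphism `Π ⥲ Π^tp_{X̲̲_k}` for every isomorph (`Classical.choice` of `IsoClass.iso`; the radial
datum only records that one exists, Ex 1.8 (i) "a topological group `Π` isomorphic to `Π^tp_{X̲̲_k}`").
[cite: Mochizuki2012, Ex 1.8 (i) p.35] -/
noncomputable def refIso (P : IsoClass S.PiX) : P.G ≃ₜ* S.PiX := Classical.choice P.iso

/-- The automorphism of the reference group `Π^tp ⥲ Π ⥲ Π* ⥲ Π^tp` determined by an isomorphism `f : Π ⥲ Π*` and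
the chosen identifications. [cite: Mochizuki2012, Ex 1.8 (i) p.36] -/
noncomputable def autOf {P P' : IsoClass S.PiX} (f : P ⟶ P') : S.PiX ≃ₜ* S.PiX :=
  (refIso P).symm.trans ((IsoClass.homIso f).trans (refIso P'))

/-- The identity determines the identity automorphism. [cite: Mochizuki2012, Ex 1.8 (i) p.36] -/
theorem autOf_id (P : IsoClass S.PiX) : autOf (𝟙 P) = ContinuousMulEquiv.refl S.PiX :=
  ContinuousMulEquiv.ext fun x => by
    change refIso P ((IsoClass.homIso (𝟙 P)) ((refIso P).symm x)) = x
    exact (refIso P).apply_symm_apply x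

/-- Composites determine composite automorphisms. [cite: Mochizuki2012, Ex 1.8 (i) p.36] -/
theorem autOf_comp {P P' P'' : IsoClass S.PiX} (f : P ⟶ P') (g : P' ⟶ P'') :
    autOf (f ≫ g) = (autOf f).trans (autOf g) :=
  ContinuousMulEquiv.ext fun x => by
    change refIso P'' (IsoClass.homIso g (IsoClass.homIso f ((refIso P).symm x))) =
      refIso P'' (IsoClass.homIso g ((refIso P').symm (refIso P' (IsoClass.homIso f ((refIso P).symm x)))))
    rw [ContinuousMulEquiv.symm_apply_apply]

variable (E₀ : ThetaEnvData.{u, u} S.PiX) (A : ThetaEnvData.AutIsoAction E₀)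

/-- The isomorphism of transported data along `f : Π ⥲ Π*`: the action of the automorphism `autOf f` of the
reference group, read on the transports along the chosen identifications. [cite: Mochizuki2012, Prop 3.4 (i) p.91] -/
noncomputable def isoAlong {P P' : IsoClass S.PiX} (f : P ⟶ P') :
    ThetaEnvData.Iso (E₀.comapAlong (refIso P).toMulEquiv) (E₀.comapAlong (refIso P').toMulEquiv) where
  phi := (IsoClass.homIso f).toMulEquiv
  e := (A.iso (autOf f)).e
  iota := (A.iso (autOf f)).iota
  map_conj g x := by
    change (A.iso (autOf f)).e (E₀.conj (refIso P g) x) = E₀.conj (refIso P' (IsoClass.homIso f g)) _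
    rw [(A.iso (autOf f)).map_conj, A.iso_phi]
    change E₀.conj (refIso P' (IsoClass.homIso f ((refIso P).symm (refIso P g)))) _ = _
    rw [ContinuousMulEquiv.symm_apply_apply]
    rfl
  map_units := (A.iso (autOf f)).map_units
  map_constants := (A.iso (autOf f)).map_constants
  image_thetaEnv ι := (A.iso (autOf f)).image_thetaEnv ι
  image_inftyThetaEnv ι := (A.iso (autOf f)).image_inftyThetaEnv ι

/-- **THE reduction (junction J10, genuine shape ⇒ transport input of J12)**: an `Aut(Π^tp_{X̲̲_k})`-action on the
reference theta-environment data by isomorphisms yields theta-environment data on EVERY isomorph `Π` (transport of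
structure along the chosen `Π ⥲ Π^tp`) with the induced "compatible collections of isomorphisms" along every
`Π ⥲ Π*`, FUNCTORIALLY — the functor laws PROVED from the action laws. [cite: Mochizuki2012, Prop 3.4 (i) p.91] -/
noncomputable def ofAutAction : ThetaEnvTransport S where
  E P := E₀.comapAlong (refIso P).toMulEquiv
  iso f := isoAlong E₀ A f
  iso_phi _ _ := rfl
  iso_id_e P x := by
    change (A.iso (autOf (𝟙 P))).e x = x
    rw [autOf_id]
    exact A.iso_refl_e x
  iso_id_iota P ι := by
    change (A.iso (autOf (𝟙 P))).iota ι = ι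
    rw [autOf_id]
    exact A.iso_refl_iota ι
  iso_comp_e f g x := by
    change (A.iso (autOf (f ≫ g))).e x = (A.iso (autOf g)).e ((A.iso (autOf f)).e x)
    rw [autOf_comp]
    exact A.iso_trans_e _ _ x
  iso_comp_iota f g ι := by
    change (A.iso (autOf (f ≫ g))).iota ι = (A.iso (autOf g)).iota ((A.iso (autOf f)).iota ι)
    rw [autOf_comp]
    exact A.iso_trans_iota _ _ ι

/-- Each transported datum IS the reference datum up to the isomorphism along the chosen identification
`Π ⥲ Π^tp_{X̲̲_k}` (so the functor of Prop 3.4 (i) built from `ofAutAction` takes, on every isomorph, the value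
`E₀` "up to the compatible collection of isomorphisms"). [cite: Mochizuki2012, Prop 3.4 (i) p.91] -/
noncomputable def baseIso (P : IsoClass S.PiX) : ThetaEnvData.Iso ((ofAutAction E₀ A).E P) E₀ :=
  ThetaEnvData.comapIso E₀ (refIso P).toMulEquiv

/-- `baseIso` lies over the chosen identification (bookkeeping). [cite: Mochizuki2012, Prop 3.4 (i) p.91] -/
theorem baseIso_phi (P : IsoClass S.PiX) (g : P.G) : (baseIso E₀ A P).phi g = refIso P g := rfl

/-- On a morphism the transport acts on the module by the reference action of the automorphism `autOf f`
(bookkeeping). [cite: Mochizuki2012, Prop 3.4 (i) p.91] -/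
theorem ofAutAction_iso_e {P P' : IsoClass S.PiX} (f : P ⟶ P') (x : E₀.H) :
    ((ofAutAction E₀ A).iso f).e x = (A.iso (autOf f)).e x := rfl

end ThetaEnvTransport

/-! ### 4. J12 at this transport -/

/-- **[IUTchII] Prop 3.4 (i) multiradiality at the functor built from an `Aut(Π^tp_{X̲̲_k})`-action on reference
theta-environment data** (instance of `prop34i_multiradiallyDefined`). [cite: Mochizuki2012, Prop 3.4 (i) p.92] -/
theorem prop34i_multiradiallyDefined_ofAutAction {S : ThetaSetting.{u}} (E₀ : ThetaEnvData.{u, u} S.PiX)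
    (A : ThetaEnvData.AutIsoAction E₀) (Γ : Type u) [Group Γ] :
    ((ex18iii S Γ).toDagger
      (prop34iRadialFunctor (ThetaEnvTransport.ofAutAction E₀ A) Γ)).IsMultiradiallyDefined :=
  prop34i_multiradiallyDefined _ Γ

/-- NON-VACUITY of the shape at the degenerate action. [folklore] -/
example {S : ThetaSetting.{u}} (Γ : Type u) [Group Γ] :
    ((ex18iii S Γ).toDagger
      (prop34iRadialFunctor
        (ThetaEnvTransport.ofAutAction _ (ThetaEnvData.AutIsoAction.trivial S.PiX)) Γ)).IsMultiradiallyDefined :=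
  prop34i_multiradiallyDefined_ofAutAction _ _ Γ

end TemperedThetaMonoids

end Literature.IUT.HodgeArakelov
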